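import Literature.Probability.LatticeModels.FKFamilyObservable
import Literature.Probability.LatticeModels.FKPrimitiveBoundaryLaplacian
import Literature.Probability.LatticeModels.FKPrimitiveBounds
import HarnessLib

/-!
# The primitive of the observable of a family: Lemma 3.8, the phantom Laplacian, `Hb ≤ H_B`

Topic `Literature/Probability/LatticeModels`; second instalment of the slit-domain observable theory
for the named fact `fkIsing_rsw` (after `FKFamilyObservable.lean`: the observable `dartObsOn`,
`vertexObsOn` of a family `C` of configurations, Lemma 4.5 on toggle-closed families, the family
primitive `IsFamilyPrimitive`). Here the analytic consequences, ported verbatim from the theory of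
the full family (`FKPrimitiveLaplacian.lean`, `FKPrimitiveBoundaryLaplacian.lean`,
`FKPrimitiveBounds.lean`) — the only change being that "interior edge" now also requires the family
to be closed under toggling the edge (`IsFamilyInteriorEdge`; for a prefix cylinder: the edge is
unexplored), and that the phantom (wired) sides of a face are the edges *forced open in the family*
(the wired arc **and the wired bank of an exploration prefix**):

* `projLine_cTgt_fam`, `projLine_cSrc_fam`, `isSHolAt_refPhase_fam`: Smirnov's projection
  identities and s-holomorphicity of `refPhase c₀ · F_C` across corners joining two family-interior
  edges;
* `latticeLaplacian_hbC_eq` / `latticeLaplacian_hwC_eq` (**Lemma 3.8** for a family primitive: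
  `Δ Hb = κ² ‖F_C(E₀) - F_C(E₂)‖² ≥ 0` at a face with four family-interior sides, dually for `Hw`),
  `IsFamilyPrimitive.subharmonicOn`, `IsFamilyPrimitive.superharmonicOn`;
* **`phantom_laplacian_hbC`** (Duminil-Copin–Hongler–Nolin's boundary trick, §3.1 eq.
  (modified_laplacian), black squares): at an inner face whose sides are family-interior or forced
  open in the family (set `P`),
  `∑_{j∉P} (Hb(f_j) - Hb(f)) - (1 - tan²(π/8)) ∑_{j∈P} (Hb(f) - Hw(a_j)) ≥ 0` — the same Appendix-C
  computation with the phantom vectors `blackPhantom` at the forced-open sides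
  (`dartObsOn_follow_of_forall_mem`);
* `DiscreteDobrushin.familyInteriorFaces`, and the **upper bound `Hb ≤ H_B`** on every inner face
  (`IsFamilyPrimitive.hb_le`): maximum principle on the family-interior faces, the boundary layer
  being the faces with a corner on `A ∪ B` (levels `H_A`, `H_B = H_A + 1`, `|F_C|² ≤ 1`) or with an
  `E`-interior side that is not family-free (hypothesis `hrev`: for a prefix cylinder these are the
  faces along the revealed edges, at level `H_B` or cornered by the wired bank).

Everything here is proved; no named fact is introduced; nothing assumes `fkIsing_rsw`.

## References

* S. Smirnov, *Conformal invariance in random cluster models. I*, Ann. of Math. 172 (2010): Lemma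
  3.8 and Appendix C, Lemma 4.1, Lemma 4.5, Lemma 4.11, proof of Lemma 5.2 — bib key `Smirnov2010`.
* H. Duminil-Copin, C. Hongler, P. Nolin, *Connection probabilities and RSW-type bounds for the
  two-dimensional FK Ising model*, Comm. Pure Appl. Math. 64 (2011), §3.1 (Proposition 8,
  eq. (modified_laplacian)), §4 (proof of Lemma 15) — bib key `DuminilCopinHonglerNolin2011`.
* H. Duminil-Copin, *Parafermionic observables and their applications*, Ensaios Mat. 25 (2013),
  Chap. 10, proof of Lemma 10.7 (the observable of the slit domain `R ∖ γ[0,T]`).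
-/

noncomputable section

namespace Literature.Probability.LatticeModels

open Complex Finset

variable {E : DiscreteDobrushin}

/-! ### Family-interior edges -/

section Interior

open scoped Classical in
/-- **A family-interior edge**: the edge `e_k` at `u` is a free edge of the family `C` (edge of `Ω_δ`,
no endpoint on `B`, not `A`–`A`, `C` closed under toggling it) and both its faces are inner. At such
edges Lemma 4.5 holds for the family observable. [cite: Smirnov2010, §3 ("interior vertex") and Remark 4.6] -/
structure IsFamilyInteriorEdge (C : Finset (Finset (Sym2 (meshDomain E.Ω E.δ)))) (u : Site 2) (k : Fin 4) : Prop where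
  /-- The edge is a free edge of the family. -/
  free : IsFamilyFreeEdge (D := E) C u k
  /-- The face on one side is inner. -/
  inner : E.IsInnerFace (faceAt u k)
  /-- The face on the other side is inner. -/
  inner' : E.IsInnerFace (faceAt u (k + 3))

namespace IsFamilyInteriorEdge

variable {C : Finset (Finset (Sym2 (meshDomain E.Ω E.δ)))} {u : Site 2} {k : Fin 4}

open scoped Classical in
/-- A family-interior edge is an interior edge of the data. [cite: Smirnov2010, §3] -/
theorem toInterior (h : IsFamilyInteriorEdge C u k) : E.IsInteriorEdge u k where
  mem_edgeSet := h.free.1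
  not_mem_zdArcB := h.free.2.1
  not_arcA := h.free.2.2.1
  inner := h.inner
  inner' := h.inner'

open scoped Classical in
/-- The same edge seen from its other endpoint is family-interior too. [cite: Smirnov2010, §3] -/
theorem reverse (h : IsFamilyInteriorEdge C u k) : IsFamilyInteriorEdge C (u + cornerUnit k) (k + 2) where
  free := by
    obtain ⟨hz, hB, hAA, htog⟩ := h.free
    refine ⟨?_, ?_, ?_, ?_⟩
    · rw [cSrc_add_cornerUnit_add_two]; exact hz
    · rw [cSrc_add_cornerUnit_add_two]; exact hB
    · rw [cornerUnit_add_two, ← sub_eq_add_neg, add_sub_cancel_right]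
      exact fun h' => hAA ⟨h'.2, h'.1⟩
    · intro a b ha hb
      rw [cornerUnit_add_two, ← sub_eq_add_neg, add_sub_cancel_right] at hb
      have := htog b a hb ha
      rwa [Sym2.eq_swap]
  inner := by rw [faceAt_add_unit_add_two]; exact h.inner'
  inner' := by rw [show k + 2 + 3 = k + 1 by omega, faceAt_add_unit_succ]; exact h.inner

end IsFamilyInteriorEdge

end Interior

/-! ### The projection identities at family-interior edges -/

section Proj

variable [Fintype (meshDomain E.Ω E.δ)]

open scoped Classical in
/-- **Projection identity at the target, family-interior edges**: for a dart `p` whose target edge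
is family-interior, `Proj[F_C(cTgt p); ℓ(p)] = κ⁻¹ · dartObsOn C p`. [cite: Smirnov2010, proof of Lemma 4.5] -/
theorem projLine_cTgt_fam (hE : E.IsZdAdmissible) (hA : ((discreteDomainGraph E.Ω E.δ).induce E.zdArcA).Preconnected)
    {C : Finset (Finset (Sym2 (meshDomain E.Ω E.δ)))} (hCsub : C ⊆ E.interfaceGraph.edgeFinset.powerset)
    {p : Site 2 × Fin 4} (hp : IsFamilyInteriorEdge C p.1 (p.2 + 1)) :
    projLine (quarterPhase (dartDir (DiscreteDobrushin.startCorner hE) p)) (vertexObsOn E hE C (cTgt p)) =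
      (((eighthPhase 1).re)⁻¹ : ℝ) * dartObsOn E hE C p := by
  obtain ⟨he, hB, hAA, htog⟩ := hp.free
  have he' : cTgt p ∈ (discreteDomainGraph E.Ω E.δ).edgeSet := he
  have hB' : ∀ x ∈ cTgt p, x ∉ E.zdArcB := hB
  have hpf : E.IsInnerFace (cFace p) := by
    change E.IsInnerFace (faceAt p.1 p.2); rw [show p.2 = p.2 + 1 + 3 by omega]; exact hp.inner'
  have hp₂f : E.IsInnerFace (cFace (cornerPartner p)) := by
    change E.IsInnerFace (faceAt (p.1 + cornerUnit (p.2 + 1)) (p.2 + 2))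
    rw [show p.2 + 2 = p.2 + 1 + 1 by omega, faceAt_add_unit_succ]; exact hp.inner
  have hk := dartObsOn_add_partner hE hA he' hB' hAA hpf hp₂f hCsub htog
  have hkr : ((eighthPhase 1).re : ℝ) ≠ 0 := by
    have := kappa_ne_zero; rw [kappa_eq_re] at this; exact_mod_cast this
  have hF : vertexObsOn E hE C (cTgt p) =
      (((eighthPhase 1).re)⁻¹ : ℝ) * (dartObsOn E hE C p + dartObsOn E hE C (cornerPartner p)) := by
    rw [hk, kappa_eq_re, ← mul_assoc]; push_cast; rw [inv_mul_cancel₀ (by exact_mod_cast hkr), one_mul]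
  obtain ⟨t, ht⟩ := dartObsOn_mem_line hE C p
  obtain ⟨t', ht'⟩ := dartObsOn_mem_line hE C (cornerPartner p)
  have hη : quarterPhase (dartDir (DiscreteDobrushin.startCorner hE) p) ≠ 0 :=
    norm_ne_zero_iff.1 (by rw [norm_quarterPhase]; exact one_ne_zero)
  rw [hF, projLine_real_mul_right, projLine_add, ht, projLine_real_mul_self hη, ht']
  rcases quarterPhase_dartDir_add_two (DiscreteDobrushin.startCorner hE) p (cornerPartner p) rfl with h | h
  · rw [h, projLine_I_mul_self, add_zero]
  · rw [h, show (t' : ℂ) * -(I * quarterPhase (dartDir (DiscreteDobrushin.startCorner hE) p)) =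
      ((-t' : ℝ) : ℂ) * (I * quarterPhase (dartDir (DiscreteDobrushin.startCorner hE) p)) by push_cast; ring,
      projLine_I_mul_self, add_zero]

open scoped Classical in
/-- **Projection identity at the source, family-interior edges**: `Proj[F_C(cSrc r); ℓ(r)] = κ⁻¹ · dartObsOn C r`.
[cite: Smirnov2010, proof of Lemma 4.5] -/
theorem projLine_cSrc_fam (hE : E.IsZdAdmissible) (hA : ((discreteDomainGraph E.Ω E.δ).induce E.zdArcA).Preconnected)
    {C : Finset (Finset (Sym2 (meshDomain E.Ω E.δ)))} (hCsub : C ⊆ E.interfaceGraph.edgeFinset.powerset)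
    {r : Site 2 × Fin 4} (hr : IsFamilyInteriorEdge C r.1 r.2) :
    projLine (quarterPhase (dartDir (DiscreteDobrushin.startCorner hE) r)) (vertexObsOn E hE C (cSrc r)) =
      (((eighthPhase 1).re)⁻¹ : ℝ) * dartObsOn E hE C r := by
  have hrot : cTgt (r.1, r.2 + 3) = cSrc r := cTgt_crossPred r
  have h31 : r.2 + 3 + 1 = r.2 := by omega
  obtain ⟨hz, hB0, hAA0, htog0⟩ := hr.free
  have he : cTgt (r.1, r.2 + 3) ∈ (discreteDomainGraph E.Ω E.δ).edgeSet := by rw [hrot]; exact hz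
  have hB : ∀ x ∈ cTgt ((r.1, r.2 + 3) : Site 2 × Fin 4), x ∉ E.zdArcB := by rw [hrot]; exact hB0
  have hpA : ¬ (r.1 ∈ E.zdArcA ∧ r.1 + cornerUnit (r.2 + 3 + 1) ∈ E.zdArcA) := by rw [h31]; exact hAA0
  have hpf : E.IsInnerFace (cFace ((r.1, r.2 + 3) : Site 2 × Fin 4)) := hr.inner'
  have hp₂f : E.IsInnerFace (cFace (cornerPartner ((r.1, r.2 + 3) : Site 2 × Fin 4))) := by
    change E.IsInnerFace (faceAt (r.1 + cornerUnit (r.2 + 3 + 1)) (r.2 + 3 + 2))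
    rw [h31, show r.2 + 3 + 2 = r.2 + 1 by omega, faceAt_add_unit_succ]; exact hr.inner
  have htog : ∀ u v : meshDomain E.Ω E.δ, u.val = r.1 → v.val = r.1 + cornerUnit (r.2 + 3 + 1) → IsToggleClosed C s(u, v) := by
    rw [h31]; exact htog0
  have hk := dartObsOn_out hE hA he hB hpA hpf hp₂f hCsub htog
  have hr' : ((r.1, r.2 + 3 + 1) : Site 2 × Fin 4) = r := Prod.ext rfl h31
  simp only [hr'] at hk
  rw [hrot] at hk
  have hkr : ((eighthPhase 1).re : ℝ) ≠ 0 := by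
    have := kappa_ne_zero; rw [kappa_eq_re] at this; exact_mod_cast this
  set r' : Site 2 × Fin 4 := (r.1 + cornerUnit (r.2 + 3 + 1), r.2 + 3 + 3) with hr'def
  have hF : vertexObsOn E hE C (cSrc r) = (((eighthPhase 1).re)⁻¹ : ℝ) * (dartObsOn E hE C r + dartObsOn E hE C r') := by
    rw [hk, kappa_eq_re, ← mul_assoc]; push_cast; rw [inv_mul_cancel₀ (by exact_mod_cast hkr), one_mul]
  obtain ⟨t, ht⟩ := dartObsOn_mem_line hE C r
  obtain ⟨t', ht'⟩ := dartObsOn_mem_line hE C r'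
  have hη : quarterPhase (dartDir (DiscreteDobrushin.startCorner hE) r) ≠ 0 :=
    norm_ne_zero_iff.1 (by rw [norm_quarterPhase]; exact one_ne_zero)
  rw [hF, projLine_real_mul_right, projLine_add, ht, projLine_real_mul_self hη, ht']
  rcases quarterPhase_dartDir_add_two (DiscreteDobrushin.startCorner hE) r r' (by rw [hr'def]; simp only; omega) with h | h
  · rw [h, projLine_I_mul_self, add_zero]
  · rw [h, show (t' : ℂ) * -(I * quarterPhase (dartDir (DiscreteDobrushin.startCorner hE) r)) =
      ((-t' : ℝ) : ℂ) * (I * quarterPhase (dartDir (DiscreteDobrushin.startCorner hE) r)) by push_cast; ring,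
      projLine_I_mul_self, add_zero]

open scoped Classical in
/-- From `Proj[F_C(e); ℓ] = κ⁻¹ dartObsOn q` to
`dartFluxOn q = (κ²/‖refPhase‖²) ‖Proj[refPhase F_C(e); cornerLine q]‖²`. [cite: Smirnov2010, Lemma 3.6] -/
theorem dartFluxOn_eq_of_projLine (hE : E.IsZdAdmissible) {C : Finset (Finset (Sym2 (meshDomain E.Ω E.δ)))}
    {q : Site 2 × Fin 4} {X : ℂ}
    (h : projLine (quarterPhase (dartDir (DiscreteDobrushin.startCorner hE) q)) X = (((eighthPhase 1).re)⁻¹ : ℝ) * dartObsOn E hE C q) :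
    dartFluxOn E hE C q = fluxConst (DiscreteDobrushin.startCorner hE) *
      ‖projLine (cornerLine q.1 (cFace q)) (refPhase (DiscreteDobrushin.startCorner hE) * X)‖ ^ 2 := by
  set c₀ := DiscreteDobrushin.startCorner hE
  have hkr : ((eighthPhase 1).re : ℝ) ≠ 0 := by
    have := kappa_ne_zero; rw [kappa_eq_re] at this; exact_mod_cast this
  have hR : ‖refPhase c₀‖ ≠ 0 := norm_ne_zero_iff.2 (refPhase_ne_zero c₀)
  rw [projLine_cornerLine_refPhase, h, norm_mul, norm_mul, Complex.norm_real, Real.norm_eq_abs, abs_inv, mul_pow, mul_pow,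
    inv_pow, sq_abs, fluxConst, dartFluxOn]
  field_simp

open scoped Classical in
/-- **`dartFluxOn` at a family-interior source edge is the rescaled `cornerFlux` of `refPhase • F_C`.**
[cite: Smirnov2010, Lemma 3.6] -/
theorem dartFluxOn_eq_source (hE : E.IsZdAdmissible) (hA : ((discreteDomainGraph E.Ω E.δ).induce E.zdArcA).Preconnected)
    {C : Finset (Finset (Sym2 (meshDomain E.Ω E.δ)))} (hCsub : C ⊆ E.interfaceGraph.edgeFinset.powerset)
    {r : Site 2 × Fin 4} (hr : IsFamilyInteriorEdge C r.1 r.2) :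
    dartFluxOn E hE C r = fluxConst (DiscreteDobrushin.startCorner hE) *
      cornerFlux (fun z => refPhase (DiscreteDobrushin.startCorner hE) * vertexObsOn E hE C z) r :=
  dartFluxOn_eq_of_projLine hE (projLine_cSrc_fam hE hA hCsub hr)

open scoped Classical in
/-- **`dartFluxOn` at a family-interior target edge, read at the target.** [cite: Smirnov2010, Lemma 3.6] -/
theorem dartFluxOn_eq_target (hE : E.IsZdAdmissible) (hA : ((discreteDomainGraph E.Ω E.δ).induce E.zdArcA).Preconnected)
    {C : Finset (Finset (Sym2 (meshDomain E.Ω E.δ)))} (hCsub : C ⊆ E.interfaceGraph.edgeFinset.powerset)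
    {p : Site 2 × Fin 4} (hp : IsFamilyInteriorEdge C p.1 (p.2 + 1)) :
    dartFluxOn E hE C p = fluxConst (DiscreteDobrushin.startCorner hE) *
      ‖projLine (cornerLine p.1 (cFace p)) (refPhase (DiscreteDobrushin.startCorner hE) * vertexObsOn E hE C (cTgt p))‖ ^ 2 :=
  dartFluxOn_eq_of_projLine hE (projLine_cTgt_fam hE hA hCsub hp)

open scoped Classical in
/-- **`refPhase • F_C` is s-holomorphic across every corner joining two family-interior edges.**
[cite: Smirnov2010, Lemma 4.5 and Remark 4.6] -/
theorem isSHolAt_refPhase_fam (hE : E.IsZdAdmissible) (hA : ((discreteDomainGraph E.Ω E.δ).induce E.zdArcA).Preconnected)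
    {C : Finset (Finset (Sym2 (meshDomain E.Ω E.δ)))} (hCsub : C ⊆ E.interfaceGraph.edgeFinset.powerset)
    {r : Site 2 × Fin 4} (hsrc : IsFamilyInteriorEdge C r.1 r.2) (htgt : IsFamilyInteriorEdge C r.1 (r.2 + 1)) :
    IsSHolAt (fun z => refPhase (DiscreteDobrushin.startCorner hE) * vertexObsOn E hE C z) r := by
  unfold IsSHolAt
  rw [projLine_cornerLine_refPhase, projLine_cornerLine_refPhase, projLine_cSrc_fam hE hA hCsub hsrc,
    projLine_cTgt_fam hE hA hCsub htgt]

end Proj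

/-! ### Lemma 3.8 for family primitives -/

section Laplacian

variable [Fintype (meshDomain E.Ω E.δ)]

open scoped Classical in
/-- **Lemma 3.8 (white squares) for a family primitive**: `Δ Hw (u) = -κ² ‖F_C(e₀) - F_C(e₂)‖² ≤ 0`
at a site whose four edges are family-interior. [cite: Smirnov2010, Lemma 3.8] -/
theorem latticeLaplacian_hwC_eq (hE : E.IsZdAdmissible) (hA : ((discreteDomainGraph E.Ω E.δ).induce E.zdArcA).Preconnected)
    {C : Finset (Finset (Sym2 (meshDomain E.Ω E.δ)))} (hCsub : C ⊆ E.interfaceGraph.edgeFinset.powerset)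
    {Hw Hb : Site 2 → ℝ} (u : Site 2) (hint : ∀ k : Fin 4, IsFamilyInteriorEdge C u k)
    (hpair : ∀ k : Fin 4, Hb (faceAt u k) - Hw u = dartFluxOn E hE C (u, k) ∧
      Hb (faceAt u k) - Hw (u + cornerUnit k) = dartFluxOn E hE C (u + cornerUnit k, k + 1)) :
    latticeLaplacian Hw u = -((eighthPhase 1).re ^ 2 *
      ‖vertexObsOn E hE C (cSrc (u, 0)) - vertexObsOn E hE C (cSrc (u, 2))‖ ^ 2) := by
  set c₀ := DiscreteDobrushin.startCorner hE with hc₀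
  set G : MedialVertex → ℂ := fun z => refPhase c₀ * vertexObsOn E hE C z with hG
  have hinc : ∀ k : Fin 4, Hw (u + cornerUnit k) - Hw u = dartFluxOn E hE C (u, k) - dartFluxOn E hE C (u + cornerUnit k, k + 1) := by
    intro k; have h1 := (hpair k).1; have h2 := (hpair k).2; linarith
  have hsrc : ∀ k : Fin 4, dartFluxOn E hE C (u, k) = fluxConst c₀ * cornerFlux G (u, k) :=
    fun k => dartFluxOn_eq_source hE hA hCsub (hint k)
  have htgt : ∀ k : Fin 4, dartFluxOn E hE C (u + cornerUnit k, k + 1) = fluxConst c₀ *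
      ‖projLine (cornerLine (u + cornerUnit k) (faceAt (u + cornerUnit k) (k + 1))) (G (cSrc (u, k)))‖ ^ 2 := by
    intro k
    have h := dartFluxOn_eq_target hE hA hCsub (p := (u + cornerUnit k, k + 1))
      (by simp only [show k + 1 + 1 = k + 2 by omega]; exact (hint k).reverse)
    rw [cTgt_add_cornerUnit_succ] at h
    exact h
  have hs : ∀ k : Fin 4, IsSHolAt G (u, k) := fun k => isSHolAt_refPhase_fam hE hA hCsub (hint k) (hint (k + 1))
  have key := sum_vertexStep_eq_neg_norm_sq' G u hs
  rw [latticeLaplacian, Finset.sum_congr rfl fun k _ => hinc k]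
  simp_rw [hsrc, htgt, ← mul_sub]
  rw [← Finset.mul_sum, key]
  have hn : ‖G (cSrc (u, 0)) - G (cSrc (u, 2))‖ ^ 2 =
      ‖refPhase c₀‖ ^ 2 * ‖vertexObsOn E hE C (cSrc (u, 0)) - vertexObsOn E hE C (cSrc (u, 2))‖ ^ 2 := by
    simp only [hG]; rw [← mul_sub, norm_mul, mul_pow]
  rw [hn, fluxConst]
  have hR : ‖refPhase c₀‖ ≠ 0 := norm_ne_zero_iff.2 (refPhase_ne_zero c₀)
  field_simp

open scoped Classical in
/-- **Lemma 3.8 (black squares) for a family primitive**: `Δ Hb (f) = κ² ‖F_C(E₀) - F_C(E₂)‖² ≥ 0`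
at a face whose four sides are family-interior. [cite: Smirnov2010, Lemma 3.8] -/
theorem latticeLaplacian_hbC_eq (hE : E.IsZdAdmissible) (hA : ((discreteDomainGraph E.Ω E.δ).induce E.zdArcA).Preconnected)
    {C : Finset (Finset (Sym2 (meshDomain E.Ω E.δ)))} (hCsub : C ⊆ E.interfaceGraph.edgeFinset.powerset)
    {Hw Hb : Site 2 → ℝ} (f : Site 2) (hint : ∀ j : Fin 4, IsFamilyInteriorEdge C (f + cornerOff j) j)
    (hpair : ∀ j : Fin 4, Hb f - Hw (f + cornerOff j) = dartFluxOn E hE C (f + cornerOff j, j) ∧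
      Hb (f + cornerUnit (j + 3)) - Hw (f + cornerOff j) = dartFluxOn E hE C (f + cornerOff j, j + 3)) :
    latticeLaplacian Hb f = (eighthPhase 1).re ^ 2 *
      ‖vertexObsOn E hE C (cSrc (f + cornerOff 0, 0)) - vertexObsOn E hE C (cSrc (f + cornerOff 2, 2))‖ ^ 2 := by
  set c₀ := DiscreteDobrushin.startCorner hE with hc₀
  set G : MedialVertex → ℂ := fun z => refPhase c₀ * vertexObsOn E hE C z with hG
  have hinc : ∀ j : Fin 4, Hb (f + cornerUnit (j + 3)) - Hb f =
      dartFluxOn E hE C (f + cornerOff j, j + 3) - dartFluxOn E hE C (f + cornerOff j, j) := by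
    intro j; have h1 := (hpair j).1; have h2 := (hpair j).2; linarith
  have hsrc : ∀ j : Fin 4, dartFluxOn E hE C (f + cornerOff j, j) = fluxConst c₀ * cornerFlux G (f + cornerOff j, j) :=
    fun j => dartFluxOn_eq_source hE hA hCsub (hint j)
  have htgt : ∀ j : Fin 4, dartFluxOn E hE C (f + cornerOff j, j + 3) = fluxConst c₀ *
      ‖projLine (cornerLine (f + cornerOff j) (faceAt (f + cornerOff j) (j + 3))) (G (cSrc (f + cornerOff j, j)))‖ ^ 2 := by
    intro j
    have h := dartFluxOn_eq_target hE hA hCsub (p := (f + cornerOff j, j + 3))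
      (by simp only [show j + 3 + 1 = j by omega]; exact hint j)
    rw [cTgt_add_three] at h
    exact h
  have hside : ∀ j : Fin 4, IsFamilyInteriorEdge C (f + cornerOff j) (j + 1) := by
    intro j
    have h := (hint (j + 3)).reverse
    rw [add_assoc, cornerOff_add_three_add_cornerUnit, show j + 3 + 2 = j + 1 by omega] at h
    exact h
  have hs : ∀ j : Fin 4, IsSHolAt G (f + cornerOff j, j) := fun j => isSHolAt_refPhase_fam hE hA hCsub (hint j) (hside j)
  have key := sum_faceStep_eq_norm_sq' G f hs
  rw [latticeLaplacian]
  rw [show ∑ k : Fin 4, (Hb (f + cornerUnit k) - Hb f) = ∑ j : Fin 4, (Hb (f + cornerUnit (j + 3)) - Hb f) from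
    (Fintype.sum_equiv (Equiv.addRight (3 : Fin 4)) (fun j => Hb (f + cornerUnit (j + 3)) - Hb f)
      (fun k => Hb (f + cornerUnit k) - Hb f) fun j => rfl).symm]
  rw [Finset.sum_congr rfl fun j _ => hinc j]
  simp_rw [hsrc, htgt, ← mul_sub]
  rw [← Finset.mul_sum, key]
  have hn : ‖G (cSrc (f + cornerOff 0, 0)) - G (cSrc (f + cornerOff 2, 2))‖ ^ 2 =
      ‖refPhase c₀‖ ^ 2 * ‖vertexObsOn E hE C (cSrc (f + cornerOff 0, 0)) - vertexObsOn E hE C (cSrc (f + cornerOff 2, 2))‖ ^ 2 := by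
    simp only [hG]; rw [← mul_sub, norm_mul, mul_pow]
  rw [hn, fluxConst]
  have hR : ‖refPhase c₀‖ ≠ 0 := norm_ne_zero_iff.2 (refPhase_ne_zero c₀)
  field_simp

end Laplacian

/-! ### The family-interior faces and sites; Laplacian signs of a family primitive -/

namespace DiscreteDobrushin

variable [Fintype (meshDomain E.Ω E.δ)]

open scoped Classical in
/-- The **family-interior faces**: faces all four of whose sides are family-interior — where a family
primitive `Hb` is subharmonic. [cite: Smirnov2010, §3 and Lemma 3.8] -/
def familyInteriorFaces (E : DiscreteDobrushin) [Fintype (meshDomain E.Ω E.δ)]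
    (C : Finset (Finset (Sym2 (meshDomain E.Ω E.δ)))) : Set (Site 2) :=
  {f | ∀ j : Fin 4, IsFamilyInteriorEdge C (f + cornerOff j) j}

open scoped Classical in
/-- The **family-interior sites**: sites all four of whose edges are family-interior — where a family
primitive `Hw` is superharmonic. [cite: Smirnov2010, §3 and Lemma 3.8] -/
def familyInteriorSites (E : DiscreteDobrushin) [Fintype (meshDomain E.Ω E.δ)]
    (C : Finset (Finset (Sym2 (meshDomain E.Ω E.δ)))) : Set (Site 2) :=
  {u | ∀ k : Fin 4, IsFamilyInteriorEdge C u k}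

variable {C : Finset (Finset (Sym2 (meshDomain E.Ω E.δ)))}

open scoped Classical in
/-- Family-interior faces are interior faces. [cite: Smirnov2010, §3] -/
theorem familyInteriorFaces_subset_interiorFaces : E.familyInteriorFaces C ⊆ E.interiorFaces :=
  fun _ hf j => (hf j).toInterior

open scoped Classical in
/-- Family-interior sites are interior sites. [cite: Smirnov2010, §3] -/
theorem familyInteriorSites_subset_interiorSites : E.familyInteriorSites C ⊆ E.interiorSites :=
  fun _ hu k => (hu k).toInterior

open scoped Classical in
/-- The family-interior faces form a finite set. [cite: Smirnov2010, §3] -/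
theorem familyInteriorFaces_finite (hE : E.IsZdAdmissible) : (E.familyInteriorFaces C).Finite :=
  (interiorFaces_finite hE).subset familyInteriorFaces_subset_interiorFaces

open scoped Classical in
/-- The family-interior sites form a finite set. [cite: Smirnov2010, §3] -/
theorem familyInteriorSites_finite (hE : E.IsZdAdmissible) : (E.familyInteriorSites C).Finite :=
  (interiorSites_finite hE).subset familyInteriorSites_subset_interiorSites

end DiscreteDobrushin

namespace IsFamilyPrimitive

variable [Fintype (meshDomain E.Ω E.δ)] {hE : E.IsZdAdmissible} {C : Finset (Finset (Sym2 (meshDomain E.Ω E.δ)))}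
  {Hw Hb : Site 2 → ℝ}

open scoped Classical in
/-- **A family primitive `Hb` is subharmonic on the family-interior faces.** [cite: Smirnov2010, Lemma 3.8] -/
theorem subharmonicOn (h : IsFamilyPrimitive hE C Hw Hb) (hA : ((discreteDomainGraph E.Ω E.δ).induce E.zdArcA).Preconnected)
    (hCsub : C ⊆ E.interfaceGraph.edgeFinset.powerset) : IsLatticeSubharmonicOn Hb (E.familyInteriorFaces C) := by
  intro f hf
  have hpair : ∀ j : Fin 4, Hb f - Hw (f + cornerOff j) = dartFluxOn E hE C (f + cornerOff j, j) ∧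
      Hb (f + cornerUnit (j + 3)) - Hw (f + cornerOff j) = dartFluxOn E hE C (f + cornerOff j, j + 3) := by
    intro j
    constructor
    · have := h (f + cornerOff j, j) (by change E.IsInnerFace (faceAt (f + cornerOff j) j); exact (hf j).inner)
      simp only [cFace] at this
      rwa [faceAt_add_cornerOff] at this
    · have := h (f + cornerOff j, j + 3) (hf j).inner'
      simp only [cFace] at this
      rwa [faceAt_face_corner_add_three] at this
  rw [latticeLaplacian_hbC_eq hE hA hCsub f hf hpair]
  exact mul_nonneg (sq_nonneg _) (sq_nonneg _)

open scoped Classical in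
/-- **A family primitive `Hw` is superharmonic on the family-interior sites.** [cite: Smirnov2010, Lemma 3.8] -/
theorem superharmonicOn (h : IsFamilyPrimitive hE C Hw Hb) (hA : ((discreteDomainGraph E.Ω E.δ).induce E.zdArcA).Preconnected)
    (hCsub : C ⊆ E.interfaceGraph.edgeFinset.powerset) : IsLatticeSuperharmonicOn Hw (E.familyInteriorSites C) := by
  intro u hu
  have hpair : ∀ k : Fin 4, Hb (faceAt u k) - Hw u = dartFluxOn E hE C (u, k) ∧
      Hb (faceAt u k) - Hw (u + cornerUnit k) = dartFluxOn E hE C (u + cornerUnit k, k + 1) := by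
    intro k
    refine ⟨h (u, k) (hu k).inner, ?_⟩
    have := h (u + cornerUnit k, k + 1) (by
      change E.IsInnerFace (faceAt (u + cornerUnit k) (k + 1)); rw [faceAt_add_unit_succ]; exact (hu k).inner)
    simp only [cFace] at this
    rwa [faceAt_add_unit_succ] at this
  rw [latticeLaplacian_hwC_eq hE hA hCsub u hu hpair]
  exact neg_nonpos.2 (mul_nonneg (sq_nonneg _) (sq_nonneg _))

end IsFamilyPrimitive

/-! ### Duminil-Copin–Hongler–Nolin's phantom Laplacian at the sides forced open in the family -/

section Black

variable [Fintype (meshDomain E.Ω E.δ)]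

open scoped Classical in
/-- **The modified Laplacian, black squares, for a family primitive** (DCHN §3.1,
eq. (modified_laplacian), at the wired sides of the slit domain: the original wired arc and the wired
bank of the prefix). Let `(Hw, Hb)` have the family primitive property at the darts of the inner face
`f` and at the darts arriving at its family-interior sides, and let every side of `f` be either
family-interior or forced open in the family (the set `P` of such sides). Then
`∑_{j ∉ P} (Hb(f_j) - Hb(f)) - (1 - tan²(π/8)) ∑_{j ∈ P} (Hb(f) - Hw(a_j)) ≥ 0`.
[cite: DuminilCopinHonglerNolin2011, §3.1, Proposition 8 and eq. (modified_laplacian)] -/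
theorem phantom_laplacian_hbC (hE : E.IsZdAdmissible) (hA : ((discreteDomainGraph E.Ω E.δ).induce E.zdArcA).Preconnected)
    {C : Finset (Finset (Sym2 (meshDomain E.Ω E.δ)))} (hCsub : C ⊆ E.interfaceGraph.edgeFinset.powerset)
    {Hw Hb : Site 2 → ℝ} (f : Site 2) (hf : E.IsInnerFace f) (P : Finset (Fin 4))
    (hint : ∀ j, j ∉ P → IsFamilyInteriorEdge C (f + cornerOff j) j)
    (hph : ∀ j ∈ P, IsForcedOpen (D := E) C (cSrc (f + cornerOff j, j)))
    (hpair : ∀ j : Fin 4, Hb f - Hw (f + cornerOff j) = dartFluxOn E hE C (f + cornerOff j, j))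
    (hpair' : ∀ j, j ∉ P → Hb (f + cornerUnit (j + 3)) - Hw (f + cornerOff j) = dartFluxOn E hE C (f + cornerOff j, j + 3)) :
    0 ≤ ∑ j ∈ univ.filter (· ∉ P), (Hb (f + cornerUnit (j + 3)) - Hb f) -
      (1 - (Real.sqrt 2 - 1) ^ 2) * ∑ j ∈ P, (Hb f - Hw (f + cornerOff j)) := by
  classical
  set c₀ := DiscreteDobrushin.startCorner hE with hc₀
  set F : MedialVertex → ℂ := vertexObsOn E hE C with hFdef
  set Es : Fin 4 → MedialVertex := fun j => cSrc (f + cornerOff j, j) with hEs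
  have hkr : ((eighthPhase 1).re : ℝ) ≠ 0 := by
    have := kappa_ne_zero; rw [kappa_eq_re] at this; exact_mod_cast this
  have hline : ∀ j : Fin 4, ∃ s : ℝ, dartObsOn E hE C (f + cornerOff (j + 1), j + 1) =
      s * quarterPhase (dartDir c₀ (f + cornerOff (j + 1), j + 1)) := fun j => dartObsOn_mem_line hE C _
  choose s hs using hline
  set w : Fin 4 → ℂ := fun j => quarterPhase (dartDir c₀ (f + cornerOff (j + 1), j + 1)) with hw
  have hwn : ∀ j, ‖w j‖ = 1 := fun j => norm_quarterPhase _
  set X : Fin 4 → ℂ := fun j => blackPhantom (((eighthPhase 1).re)⁻¹ * s j) (w j) with hX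
  set Y : Fin 4 → ℂ := fun j => if j ∈ P then X j else F (Es j) with hY
  set F' : MedialVertex → ℂ :=
    Function.update (Function.update (Function.update (Function.update F (Es 0) (Y 0)) (Es 1) (Y 1)) (Es 2) (Y 2)) (Es 3) (Y 3)
    with hF'
  have hinj := cSrc_face_corner_injective f
  have hF'E : ∀ j, F' (Es j) = Y j := by
    intro j
    fin_cases j
    · show F' (Es 0) = Y 0
      rw [hF', Function.update_of_ne (hinj.ne (by decide)), Function.update_of_ne (hinj.ne (by decide)),
        Function.update_of_ne (hinj.ne (by decide)), Function.update_self]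
    · show F' (Es 1) = Y 1
      rw [hF', Function.update_of_ne (hinj.ne (by decide)), Function.update_of_ne (hinj.ne (by decide)),
        Function.update_self]
    · show F' (Es 2) = Y 2
      rw [hF', Function.update_of_ne (hinj.ne (by decide)), Function.update_self]
    · show F' (Es 3) = Y 3
      rw [hF', Function.update_self]
  set G : MedialVertex → ℂ := fun z => refPhase c₀ * F' z with hG
  have i13 : ∀ j : Fin 4, j + 1 + 3 = j := fun j => by omega
  have i31 : ∀ j : Fin 4, j + 3 + 1 = j := fun j => by omega
  have hcorner : ∀ j : Fin 4, (f + cornerOff (j + 1) + cornerUnit (j + 1 + 1), j + 1 + 3) = ((f + cornerOff j, j) : Site 2 × Fin 4) := by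
    intro j
    rw [Prod.mk.injEq]
    exact ⟨by rw [show j + 1 + 1 = j + 2 by omega, add_assoc, cornerOff_succ_add_cornerUnit_add_two], i13 j⟩
  -- the followed-open relation at a forced-open side
  have hfollow : ∀ j ∈ P, dartObsOn E hE C (f + cornerOff j, j) =
      quarterPhase (-1) * dartObsOn E hE C (f + cornerOff (j + 1), j + 1) := by
    intro j hj
    have hqf : E.IsInnerFace (cFace ((f + cornerOff (j + 1), j + 1) : Site 2 × Fin 4)) := by rw [cFace_face_corner]; exact hf
    have htgt : cTgt ((f + cornerOff (j + 1), j + 1) : Site 2 × Fin 4) = Es j := cTgt_face_corner f (i13 j).symm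
    have hopen : ∀ ω ∈ C, cTgt ((f + cornerOff (j + 1), j + 1) : Site 2 × Fin 4) ∈ E.bcBondConfig (liftConfig E.Ω E.δ ω) := by
      rw [htgt]; exact hph j hj
    have := dartObsOn_follow_of_forall_mem hE C hqf hopen
    rwa [hcorner j] at this
  have hsrc : ∀ j : Fin 4, projLine (quarterPhase (dartDir c₀ (f + cornerOff j, j))) (F' (Es j)) =
      (((eighthPhase 1).re)⁻¹ : ℝ) * dartObsOn E hE C (f + cornerOff j, j) := by
    intro j
    rw [hF'E]
    by_cases hj : j ∈ P
    · simp only [hY, if_pos hj, hX]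
      rcases quarterPhase_dartDir_add_three c₀ (f + cornerOff (j + 1), j + 1) (f + cornerOff j, j) (i13 j).symm with h3 | h3
      · rw [projLine_blackPhantom_turn (hwn j) _ (Or.inl h3), hfollow j hj, hs j]; push_cast; ring
      · rw [projLine_blackPhantom_turn (hwn j) _ (Or.inr h3), hfollow j hj, hs j]; push_cast; ring
    · simp only [hY, if_neg hj]
      exact projLine_cSrc_fam hE hA hCsub (hint j hj)
  have htgtE : ∀ j : Fin 4, cTgt ((f + cornerOff j, j) : Site 2 × Fin 4) = Es (j + 3) := fun j => cTgt_face_corner f rfl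
  have htgt : ∀ j : Fin 4, projLine (quarterPhase (dartDir c₀ (f + cornerOff j, j))) (F' (Es (j + 3))) =
      (((eighthPhase 1).re)⁻¹ : ℝ) * dartObsOn E hE C (f + cornerOff j, j) := by
    intro j
    rw [hF'E]
    by_cases hj : j + 3 ∈ P
    · simp only [hY, if_pos hj, hX]
      have e : ((f + cornerOff (j + 3 + 1), j + 3 + 1) : Site 2 × Fin 4) = (f + cornerOff j, j) := by rw [i31]
      simp only [hw, e]
      rw [projLine_blackPhantom_self (by rw [← e]; exact hwn (j + 3))]
      have := hs (j + 3)
      rw [e] at this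
      rw [this]; push_cast; ring
    · simp only [hY, if_neg hj]
      have hside : IsFamilyInteriorEdge C (f + cornerOff j) (j + 1) := by
        have h := (hint (j + 3) hj).reverse
        rw [add_assoc, cornerOff_add_three_add_cornerUnit, show j + 3 + 2 = j + 1 by omega] at h
        exact h
      have := projLine_cTgt_fam hE hA hCsub (p := (f + cornerOff j, j)) hside
      rwa [htgtE] at this
  have hshol : ∀ j : Fin 4, IsSHolAt G (f + cornerOff j, j) := by
    intro j
    show projLine (cornerLine ((f + cornerOff j, j) : Site 2 × Fin 4).1 (cFace ((f + cornerOff j, j) : Site 2 × Fin 4)))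
        (refPhase c₀ * F' (cSrc (f + cornerOff j, j))) =
      projLine (cornerLine ((f + cornerOff j, j) : Site 2 × Fin 4).1 (cFace ((f + cornerOff j, j) : Site 2 × Fin 4)))
        (refPhase c₀ * F' (cTgt (f + cornerOff j, j)))
    rw [projLine_cornerLine_refPhase, projLine_cornerLine_refPhase, htgtE j]
    congr 1
    exact (hsrc j).trans (htgt j).symm
  have hflux_in : ∀ j : Fin 4, dartFluxOn E hE C (f + cornerOff j, j) = fluxConst c₀ * cornerFlux G (f + cornerOff j, j) := by
    intro j
    rw [dartFluxOn_eq_of_projLine hE (hsrc j)]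
    rfl
  have hflux_out_int : ∀ j, j ∉ P → dartFluxOn E hE C (f + cornerOff j, j + 3) = fluxConst c₀ *
      ‖projLine (cornerLine (f + cornerOff j) (faceAt (f + cornerOff j) (j + 3))) (G (Es j))‖ ^ 2 := by
    intro j hj
    have h := dartFluxOn_eq_target hE hA hCsub (p := (f + cornerOff j, j + 3)) (by rw [i31]; exact hint j hj)
    rw [cTgt_add_three] at h
    rw [h]
    congr 2
    simp only [hG, hF'E, hY, if_neg hj]
    rfl
  have hflux_out_ph : ∀ j ∈ P, fluxConst c₀ *
      ‖projLine (cornerLine (f + cornerOff j) (faceAt (f + cornerOff j) (j + 3))) (G (Es j))‖ ^ 2 =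
        (Real.sqrt 2 - 1) ^ 2 * dartFluxOn E hE C (f + cornerOff j, j) := by
    intro j hj
    simp only [hG, hF'E, hY, if_pos hj]
    have hl : cornerLine (f + cornerOff j) (faceAt (f + cornerOff j) (j + 3)) =
        cornerLine ((f + cornerOff j, j + 3) : Site 2 × Fin 4).1 (cFace ((f + cornerOff j, j + 3) : Site 2 × Fin 4)) := rfl
    rw [hl, projLine_cornerLine_refPhase, norm_mul, mul_pow]
    rcases quarterPhase_dartDir_add_two c₀ (f + cornerOff (j + 1), j + 1) (f + cornerOff j, j + 3)
      (by simp only; omega) with h2 | h2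
    · rw [h2, hX, norm_projLine_blackPhantom_perp_sq (hwn j) _ (Or.inl rfl)]
      rw [dartFluxOn, hfollow j hj, hs j, norm_mul, norm_mul, norm_quarterPhase, norm_quarterPhase, Complex.norm_real,
        Real.norm_eq_abs, one_mul, mul_one, sq_abs, fluxConst]
      have hR : ‖refPhase c₀‖ ≠ 0 := norm_ne_zero_iff.2 (refPhase_ne_zero c₀)
      field_simp
    · rw [h2, hX, norm_projLine_blackPhantom_perp_sq (hwn j) _ (Or.inr rfl)]
      rw [dartFluxOn, hfollow j hj, hs j, norm_mul, norm_mul, norm_quarterPhase, norm_quarterPhase, Complex.norm_real,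
        Real.norm_eq_abs, one_mul, mul_one, sq_abs, fluxConst]
      have hR : ‖refPhase c₀‖ ≠ 0 := norm_ne_zero_iff.2 (refPhase_ne_zero c₀)
      field_simp
  have key := sum_faceStep_eq_norm_sq' G f hshol
  have hpos : 0 ≤ fluxConst c₀ * ∑ j : Fin 4,
      (‖projLine (cornerLine (f + cornerOff j) (faceAt (f + cornerOff j) (j + 3))) (G (cSrc (f + cornerOff j, j)))‖ ^ 2 -
        cornerFlux G (f + cornerOff j, j)) := by
    rw [key]; exact mul_nonneg (fluxConst_pos c₀).le (sq_nonneg _)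
  have hterm : ∀ j : Fin 4, fluxConst c₀ *
      (‖projLine (cornerLine (f + cornerOff j) (faceAt (f + cornerOff j) (j + 3))) (G (cSrc (f + cornerOff j, j)))‖ ^ 2 -
        cornerFlux G (f + cornerOff j, j)) =
      (if j ∈ P then -((1 - (Real.sqrt 2 - 1) ^ 2) * (Hb f - Hw (f + cornerOff j)))
        else Hb (f + cornerUnit (j + 3)) - Hb f) := by
    intro j
    rw [mul_sub, ← hflux_in j]
    by_cases hj : j ∈ P
    · rw [if_pos hj, show cSrc (f + cornerOff j, j) = Es j from rfl, hflux_out_ph j hj, ← hpair j]; ring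
    · rw [if_neg hj, show cSrc (f + cornerOff j, j) = Es j from rfl, ← hflux_out_int j hj, ← hpair j, ← hpair' j hj]; ring
  rw [Finset.mul_sum, Finset.sum_congr rfl fun j _ => hterm j, Finset.sum_ite] at hpos
  rw [Finset.sum_neg_distrib, ← Finset.mul_sum] at hpos
  have hPf : univ.filter (fun j => j ∈ P) = P := by ext j; simp
  rw [hPf] at hpos
  linarith

end Black

/-! ### The upper bound `Hb ≤ H_B` for a family primitive -/

namespace IsFamilyPrimitive

variable [Fintype (meshDomain E.Ω E.δ)] {hE : E.IsZdAdmissible} {C : Finset (Finset (Sym2 (meshDomain E.Ω E.δ)))}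
  {Hw Hb : Site 2 → ℝ}

open scoped Classical in
/-- The face across an edge of a family-interior face is inner. [cite: Smirnov2010, §3] -/
theorem _root_.Literature.Probability.LatticeModels.DiscreteDobrushin.isInnerFace_add_cornerUnit_of_familyInteriorFace
    {f : Site 2} (hf : f ∈ E.familyInteriorFaces C) (k : Fin 4) : E.IsInnerFace (f + cornerUnit k) :=
  DiscreteDobrushin.isInnerFace_add_cornerUnit_of_interiorFace (DiscreteDobrushin.familyInteriorFaces_subset_interiorFaces hf) k

open scoped Classical in
/-- **Upper bound `Hb ≤ H_B` on every inner face, for a family primitive.** Hypotheses: the family is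
nonempty; `Hw` takes the value `H_A = Hw(a)` at the `A`-sites cornering an inner face and the value
`H_B = Hw(b'')` at such `B`-sites (`hcA`, `hcB`); and along every interior edge of the data that is
*not* a free edge of the family (for a prefix cylinder: the revealed edges) both faces are already
known to be at most `H_B` (`hrev`). Then `Hb ≤ H_B` everywhere, by the maximum principle for the
subharmonic `Hb` on the family-interior faces: a non-family-interior inner face has a corner on `A`
(`Hb = H_A + |F_C|² ≤ H_A + 1 = H_B`), or on `B` (`Hb = H_B`), or a non-free interior side.
[cite: Smirnov2010, proof of Lemma 5.2 (maximum principle)] -/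
theorem hb_le (h : IsFamilyPrimitive hE C Hw Hb) (hC : C.Nonempty)
    (hA : ((discreteDomainGraph E.Ω E.δ).induce E.zdArcA).Preconnected) (hCsub : C ⊆ E.interfaceGraph.edgeFinset.powerset)
    (hcA : ∀ a ∈ E.zdArcA, (∃ k, E.IsInnerFace (faceAt a k)) → Hw a = Hw (DiscreteDobrushin.startCorner hE).1)
    (hcB : ∀ b ∈ E.zdArcB, (∃ k, E.IsInnerFace (faceAt b k)) →
      Hw b = Hw ((DiscreteDobrushin.startCorner hE).1 + cornerUnit (DiscreteDobrushin.startCorner hE).2))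
    (hrev : ∀ (u : Site 2) (k : Fin 4), E.IsInteriorEdge u k → ¬ IsFamilyFreeEdge (D := E) C u k →
      Hb (faceAt u k) ≤ Hw ((DiscreteDobrushin.startCorner hE).1 + cornerUnit (DiscreteDobrushin.startCorner hE).2) ∧
      Hb (faceAt u (k + 3)) ≤ Hw ((DiscreteDobrushin.startCorner hE).1 + cornerUnit (DiscreteDobrushin.startCorner hE).2))
    {f : Site 2} (hf : E.IsInnerFace f) :
    Hb f ≤ Hw ((DiscreteDobrushin.startCorner hE).1 + cornerUnit (DiscreteDobrushin.startCorner hE).2) := by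
  have hjump := h.jump_startCorner hC
  set HB := Hw ((DiscreteDobrushin.startCorner hE).1 + cornerUnit (DiscreteDobrushin.startCorner hE).2) with hHB
  -- non-family-interior inner faces
  have key : ∀ f : Site 2, E.IsInnerFace f → f ∉ E.familyInteriorFaces C → Hb f ≤ HB := by
    intro f hf hint
    by_cases hintE : f ∈ E.interiorFaces
    · -- some side is `E`-interior but not a free family edge
      simp only [DiscreteDobrushin.familyInteriorFaces, Set.mem_setOf_eq, not_forall] at hint
      obtain ⟨j, hj⟩ := hint
      have hIE : E.IsInteriorEdge (f + cornerOff j) j := hintE j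
      have hnotfree : ¬ IsFamilyFreeEdge (D := E) C (f + cornerOff j) j := fun hfree =>
        hj ⟨hfree, hIE.inner, hIE.inner'⟩
      have := (hrev _ _ hIE hnotfree).1
      rwa [faceAt_add_cornerOff] at this
    · obtain ⟨j, hj⟩ := DiscreteDobrushin.exists_corner_mem_arcs_of_not_interiorFace hE hf hintE
      have hfj : E.IsInnerFace (faceAt (f + cornerOff j) j) := by rw [faceAt_add_cornerOff]; exact hf
      rcases hj with hjA | hjB
      · have p := h (f + cornerOff j, j) hfj
        simp only [cFace] at p
        rw [faceAt_add_cornerOff] at p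
        have hca := hcA _ hjA ⟨j, hfj⟩
        linarith [dartFluxOn_le_one hE hC (f + cornerOff j, j)]
      · have := h.hb_eq_hw_of_mem_zdArcB hjB hfj
        rw [faceAt_add_cornerOff] at this
        rw [this, hcB _ hjB ⟨j, hfj⟩]
  by_cases hint : f ∈ E.familyInteriorFaces C
  · refine (h.subharmonicOn hA hCsub).le_of_forall_boundary_le (DiscreteDobrushin.familyInteriorFaces_finite hE)
      (fun w hw => ?_) f hint
    obtain ⟨hwS, f', hf', k, rfl⟩ := hw
    exact key _ (DiscreteDobrushin.isInnerFace_add_cornerUnit_of_familyInteriorFace hf' k) hwS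
  · exact key f hf hint

open scoped Classical in
/-- `0 ≤ H_B - Hb` on every inner face (the form used for the lower harmonic-measure comparison).
[cite: Smirnov2010, proof of Lemma 5.2] -/
theorem sub_hb_nonneg (h : IsFamilyPrimitive hE C Hw Hb) (hC : C.Nonempty)
    (hA : ((discreteDomainGraph E.Ω E.δ).induce E.zdArcA).Preconnected) (hCsub : C ⊆ E.interfaceGraph.edgeFinset.powerset)
    (hcA : ∀ a ∈ E.zdArcA, (∃ k, E.IsInnerFace (faceAt a k)) → Hw a = Hw (DiscreteDobrushin.startCorner hE).1)
    (hcB : ∀ b ∈ E.zdArcB, (∃ k, E.IsInnerFace (faceAt b k)) →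
      Hw b = Hw ((DiscreteDobrushin.startCorner hE).1 + cornerUnit (DiscreteDobrushin.startCorner hE).2))
    (hrev : ∀ (u : Site 2) (k : Fin 4), E.IsInteriorEdge u k → ¬ IsFamilyFreeEdge (D := E) C u k →
      Hb (faceAt u k) ≤ Hw ((DiscreteDobrushin.startCorner hE).1 + cornerUnit (DiscreteDobrushin.startCorner hE).2) ∧
      Hb (faceAt u (k + 3)) ≤ Hw ((DiscreteDobrushin.startCorner hE).1 + cornerUnit (DiscreteDobrushin.startCorner hE).2))
    {f : Site 2} (hf : E.IsInnerFace f) :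
    0 ≤ Hw ((DiscreteDobrushin.startCorner hE).1 + cornerUnit (DiscreteDobrushin.startCorner hE).2) - Hb f :=
  sub_nonneg.2 (h.hb_le hC hA hCsub hcA hcB hrev hf)

end IsFamilyPrimitive

end Literature.Probability.LatticeModels
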